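import Literature.Probability.RandomPlanarGeometry.SLERSObservableIto
import Literature.Probability.RandomPlanarGeometry.SLECriticalGhat
import Literature.Probability.RandomPlanarGeometry.SLEOnePointEstimate
import HarnessLib

/-!
# The one-point lower estimate for the SLE_κ trace, `κ < 8` (Beffara (2008), Prop. 4, lower half)

Topic `Probability/RandomPlanarGeometry`; theorems and three auxiliary definitions (a stopping
time and an event). For `0 < κ < 8`, SLE_κ generated by a curve (`HasSLETrace κ`, Rohde–Schramm's
Thm. 5.1, a theorem of the tree for `κ ≠ 8`), `z ∈ ℍ` and `0 < ε < Im z`,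

  `P[ dist(z, γ[0,∞)) ≤ ε ] ≥ ½ (sin arg z)^{8/κ-1} (ε / (2 Im z))^{1-κ/8}`   (`measure_infDist_sleTrace_le_ge`),

the **lower** half of V. Beffara, *The dimension of the SLE curves*, Ann. Probab. 36 (2008),
**Prop. 4** ("`P(B(z₀, ε) ∩ H ≠ ∅) ≍ (ε/Im z₀)^{1-κ/8} (sin arg z₀)^{8/κ-1}`"; also Lawler (2005),
Thm. 7.9, lower half), and its compact-set form `exists_onePoint_lower_of_isCompact` — exactly the
hypothesis `hB` ("condition 1, lower half") of the assembly
`ae_dimH_range_sleTrace_of_root_facts_of_local_estimates` of Beffara's dimension theorem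
(`CritPercSLEDimensionLower.lean`). The upper half is `measure_infDist_sleTrace_le`
(`SLEOnePointEstimate.lean`).

## Proof (Beffara's proof of Prop. 4, "originally due to Oded Schramm", in Rohde–Schramm's coordinates)

Beffara's diffusion `θₛ = 2 arg z_{t(s)}` in the clock `s = log ψₜ` and his local martingale
`Xₛ = sin(θₛ/2)^{8/κ-1} e^{(1-κ/8)s}` (eq. (2.8)) are, in the variables of Rohde–Schramm's Lemma 6.3
(`zₜ = gₜ(z) - Wₜ = xₜ + i yₜ`, `wₜ = xₜ/yₜ = cot arg zₜ`, `ψₜ = (Im z)|gₜ'(z)|/Im gₜ(z)`), the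
observable `Mₜ = ψₜ^a Ĝ_{a,κ}(zₜ)` at the **critical exponent `a = 1 - κ/8`**, for which
"`Ĝ` simplifies to `(y/|z|)^{(8-κ)/κ}`" (Rohde–Schramm (2005), p. 905), i.e.
`Ĝ_{1-κ/8,κ}(w + i) = (1 + w²)^{-(4/κ-1/2)} = (sin arg)^{8/κ-1}` (`rsGhatSlope_critical`,
`SLECriticalGhat.lean`; write `h(w)` for this profile: `0 < h ≤ 1`, even, `h(s) → 0`).

* The Itô step is the tree's `martingale_stoppedProcess_sleRSObservable_of_le_locTime`
  (`SLERSObservableIto.lean`, any real `a` with `32aκ + (2κ-8)² ≥ 0`; here the discriminant is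
  `64`), applied at the stopping time `σₙ = σ_R ∧ T_S ∧ ρₙ` (`sleOnePtTime`: `ψ` reaches `R`, or
  `|w|` reaches `S`, capped by the localizing time `ρₙ` of `SLEPointFlow.lean`):
  `E[M_{σₙ}] = h(w₀)`, `h(w) = (1 + w²)^{-(4/κ-1/2)}`, and `0 ≤ M_{σₙ} ≤ R^{1-κ/8}`.
* On the complement of the event `A_R = {ψ reaches R before τ(z)}` (`slePsiReach`, measurable), the
  slope must exit `[-S, S]` (else `ψ → ∞`, `Loewner.tendsto_derivRatio_atTop_of_abs_cotArg_le`), so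
  for `n` large `σₙ = T_S` and `M_{σₙ} = ψ_{T_S}^{1-κ/8} h(S) ≤ R^{1-κ/8} h(S)`; by dominated
  convergence `h(w₀) ≤ R^{1-κ/8} P(A_R) + R^{1-κ/8} h(S)`, and choosing `S` with
  `h(S) ≤ h(w₀)/(2R^{1-κ/8})` gives the **tail bound `P(A_R) ≥ ½ h(w₀) R^{-(1-κ/8)}`**
  (`rsGhatSlope_le_measureReal_slePsiReach`). This is (2.8) read as a lower bound:
  `sin(α₀/2)^{8/κ-1} = e^{(1-κ/8)s} P(S ≥ s) E[sin(α_s/2)^{8/κ-1} | S ≥ s] ≤ e^{(1-κ/8)s} P(S ≥ s)`.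
* Geometry (Rohde–Schramm's (6.2), Schwarz direction, proved in `SLETraceDensity.lean`): on `A_R`,
  `dist(z, γ[0,∞) ∪ ℝ) ≤ dist(z, ∂Hₜ) ≤ 2 Im gₜ(z)/|gₜ'(z)| ≤ 2 Im z/R`, and for `R > 2` the nearby
  point is on the trace (`infDist_sleTrace_le_of_mem_slePsiReach`); take `R = 2 Im z/ε`.

## References

* V. Beffara, *The dimension of the SLE curves*, Ann. Probab. 36 (2008) 1421–1452
  (arXiv:math/0211322v3), Prop. 4 and its proof (eqs. (2.6)–(2.8)).
* S. Rohde, O. Schramm, *Basic properties of SLE*, Ann. of Math. 161 (2005), Lemma 6.3 and its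
  proof (p. 905: the case `a = 1 - κ/8`), eq. (6.2).
* G. F. Lawler, *Conformally Invariant Processes in the Plane*, AMS (2005), Thm. 7.9.
-/

noncomputable section

open Set Filter MeasureTheory Metric Complex
open _root_.Topology
open UpperHalfPlane (upperHalfPlaneSet)
open scoped NNReal ENNReal Real

namespace Literature.Probability.RandomPlanarGeometry

/-! ### The stopping times: `ψ` reaches `R`, `|w|` reaches `S`, capped by `ρₙ` -/

section Times

open Loewner Literature.Probability.Process Literature.Analysis.FunctionSpaces

variable (κ : ℝ≥0) (z : ℂ)

/-- The first time the ratio `ψ` (frozen at the localizing time `ρₙ`) leaves `(0, R)`, i.e. reaches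
the level `R` (`ψ ≥ 1 > 0`). [folklore] -/
def slePsiExitTime (R : ℝ) (n : ℕ) : (ℝ≥0 → ℝ) → WithTop ℝ≥0 :=
  exitTime (stoppedProcess (slePointPsi κ z) (slePointLocTime κ z n)) 0 R

/-- **The stopping time of the one-point lower bound**: `σₙ = σ_R ∧ T_S ∧ ρₙ` — the first time `ψ`
reaches `R`, or the slope `|w|` reaches `S`, capped by the localizing time `ρₙ`. [folklore] -/
def sleOnePtTime (R S : ℝ) (n : ℕ) (ω : ℝ≥0 → ℝ) : WithTop ℝ≥0 :=
  min (slePsiExitTime κ z R n ω) (sleCotArgLocTime κ z S n ω)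

variable {κ z}

/-- `σₙ ≤ T_S ∧ ρₙ`. [folklore] -/
theorem sleOnePtTime_le_cotArgLocTime (R S : ℝ) (n : ℕ) (ω : ℝ≥0 → ℝ) :
    sleOnePtTime κ z R S n ω ≤ sleCotArgLocTime κ z S n ω := min_le_right _ _

/-- `σₙ ≤ ρₙ`. [folklore] -/
theorem sleOnePtTime_le_locTime (R S : ℝ) (n : ℕ) (ω : ℝ≥0 → ℝ) :
    sleOnePtTime κ z R S n ω ≤ slePointLocTime κ z n ω :=
  (sleOnePtTime_le_cotArgLocTime R S n ω).trans (sleCotArgLocTime_le_locTime S n ω)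

/-- `σₙ ≤ σ_R`. [folklore] -/
theorem sleOnePtTime_le_psiExitTime (R S : ℝ) (n : ℕ) (ω : ℝ≥0 → ℝ) :
    sleOnePtTime κ z R S n ω ≤ slePsiExitTime κ z R n ω := min_le_left _ _

/-- The frozen ratio is adapted (measurable form). [folklore] -/
theorem adapted_stoppedProcess_slePointPsi_locTime (hz : 0 < z.im) (n : ℕ) :
    Adapted brownianFiltration (stoppedProcess (slePointPsi κ z) (slePointLocTime κ z n)) := fun t ↦
  (stronglyAdapted_stoppedProcess_slePointPsi hz (isStoppingTime_slePointLocTime κ hz n)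
    (fun _ ↦ le_rfl) t).measurable

/-- **`σₙ` is a stopping time** of the raw Brownian filtration (exit time of a continuous adapted
process; `T_S ∧ ρₙ` is one by `isStoppingTime_sleCotArgLocTime`). [folklore] -/
theorem isStoppingTime_sleOnePtTime (hz : 0 < z.im) (R S : ℝ) (n : ℕ) :
    IsStoppingTime brownianFiltration (sleOnePtTime κ z R S n) :=
  (isStoppingTime_exitTime (adapted_stoppedProcess_slePointPsi_locTime hz n)
    (continuous_stoppedProcess_slePointPsi hz fun _ ↦ le_rfl)).min
    (isStoppingTime_sleCotArgLocTime hz S n)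

/-- **Before `σₙ` (inclusive) the ratio is at most `R`** (`R > 1`): up to the exit time from
`(0, R)` the frozen ratio lies in `[0, R]`. [folklore] -/
theorem derivRatio_le_of_le_sleOnePtTime (hz : 0 < z.im) {R : ℝ} (hR : 1 < R) {S : ℝ} {n : ℕ}
    {ω : ℝ≥0 → ℝ} {t : ℝ≥0} (ht : (t : WithTop ℝ≥0) ≤ sleOnePtTime κ z R S n ω) :
    derivRatio (sleDriving κ ω) z t ≤ R := by
  have htρ : (t : WithTop ℝ≥0) ≤ slePointLocTime κ z n ω := ht.trans (sleOnePtTime_le_locTime R S n ω)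
  have hval : stoppedProcess (slePointPsi κ z) (slePointLocTime κ z n) t ω =
      derivRatio (sleDriving κ ω) z t := by
    rw [stoppedProcess_eq_of_le htρ]; rfl
  have h0 : stoppedProcess (slePointPsi κ z) (slePointLocTime κ z n) 0 ω ∈ Ioo 0 R := by
    rw [stoppedProcess_slePointPsi_zero hz]
    exact ⟨one_pos, hR⟩
  have hc := continuous_stoppedProcess_slePointPsi hz (σ := slePointLocTime κ z n)
    (fun _ ↦ le_rfl) ω (κ := κ) (n := n)
  have htσ : (t : WithTop ℝ≥0) ≤ slePsiExitTime κ z R n ω := ht.trans (sleOnePtTime_le_psiExitTime R S n ω)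
  rcases htσ.lt_or_eq with hlt | heq
  · rw [← hval]
    exact (mem_Ioo_of_coe_lt_exitTime hlt).2.le
  · rw [← hval]
    rcases apply_eq_or_eq_of_exitTime_eq_coe hc h0 heq.symm with h | h
    · rw [h]; exact zero_le_one.trans hR.le
    · exact h.le

/-- On `[0, σₙ]` the slope is bounded by `S`, provided `|w₀| < S`. [folklore] -/
theorem abs_cotArg_le_of_le_sleOnePtTime (hz : 0 < z.im) {S : ℝ} (h0 : |z.re / z.im| < S) {R : ℝ}
    {n : ℕ} {ω : ℝ≥0 → ℝ} {t : ℝ≥0} (ht : (t : WithTop ℝ≥0) ≤ sleOnePtTime κ z R S n ω) :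
    |cotArg (sleDriving κ ω) z t| ≤ S :=
  abs_cotArg_le_of_le_sleCotArgLocTime hz h0 (ht.trans (sleOnePtTime_le_cotArgLocTime R S n ω))

end Times

/-! ### The critical martingale stopped at `σₙ`: expectation, bounds, limit -/

section Martingale

open Loewner Literature.Probability.Process Literature.Analysis.FunctionSpaces

variable {κ : ℝ≥0} {z : ℂ}

/-- The stopped value `M_{t ∧ σₙ}` in closed form: with `u = t ∧ σₙ < τ(z)`,
`M_{t∧σₙ} = ψᵤ^{1-κ/8} h(wᵤ)`, `h = rsGhatSlope (1-κ/8) κ`. [cite: RohdeSchramm2005, Lemma 6.3 (proof)] -/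
theorem stoppedProcess_sleRSObservable_sleOnePtTime_eq (hz : 0 < z.im) (R S : ℝ) (n : ℕ) (t : ℝ≥0)
    (ω : ℝ≥0 → ℝ) :
    stoppedProcess (sleRSObservable κ (1 - (κ : ℝ) / 8) z) (sleOnePtTime κ z R S n) t ω =
      derivRatio (sleDriving κ ω) z ((min (t : WithTop ℝ≥0) (sleOnePtTime κ z R S n ω)).untopA) ^
          (1 - (κ : ℝ) / 8) *
        rsGhatSlope (1 - (κ : ℝ) / 8) κ
          (cotArg (sleDriving κ ω) z ((min (t : WithTop ℝ≥0) (sleOnePtTime κ z R S n ω)).untopA)) := by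
  have hT := coe_untopA_min_lt_swallowingTime hz (sleOnePtTime_le_locTime R S n) t ω (κ := κ)
  have him : (centredMap (sleDriving κ ω)
      ((min (t : WithTop ℝ≥0) (sleOnePtTime κ z R S n ω)).untopA) z).im ≠ 0 :=
    (im_centredMap_pos (continuous_sleDriving κ ω) hz hT).ne'
  rw [stoppedProcess, sleRSObservable, rsObservable_of_lt hT, rsGhat_eq_rsGhatSlope _ _ him,
    ← cotArg_apply]

/-- **`0 ≤ M_{t∧σₙ} ≤ R^{1-κ/8}`** (`0 < κ ≤ 8`, `R > 1`): `1 ≤ ψ ≤ R` up to `σₙ` and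
`0 < h ≤ 1`. [folklore] -/
theorem stoppedProcess_sleRSObservable_sleOnePtTime_mem_Icc (hκ : 0 < κ) (hκ8 : κ ≤ 8)
    (hz : 0 < z.im) {R : ℝ} (hR : 1 < R) (S : ℝ) (n : ℕ) (t : ℝ≥0) (ω : ℝ≥0 → ℝ) :
    stoppedProcess (sleRSObservable κ (1 - (κ : ℝ) / 8) z) (sleOnePtTime κ z R S n) t ω ∈
      Icc (0 : ℝ) (R ^ (1 - (κ : ℝ) / 8)) := by
  rw [stoppedProcess_sleRSObservable_sleOnePtTime_eq hz R S n t ω]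
  set u : ℝ≥0 := (min (t : WithTop ℝ≥0) (sleOnePtTime κ z R S n ω)).untopA with hu
  have huσ : (u : WithTop ℝ≥0) ≤ sleOnePtTime κ z R S n ω :=
    (coe_untopA_min_le_and_le t (sleOnePtTime κ z R S n ω)).1
  have hT := coe_untopA_min_lt_swallowingTime hz (sleOnePtTime_le_locTime R S n) t ω (κ := κ)
  have hψ1 : 1 ≤ derivRatio (sleDriving κ ω) z u := one_le_derivRatio (continuous_sleDriving κ ω) hz hT
  have hψR : derivRatio (sleDriving κ ω) z u ≤ R := derivRatio_le_of_le_sleOnePtTime hz hR huσ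
  have hlam : 0 ≤ 1 - (κ : ℝ) / 8 := by
    have : (κ : ℝ) ≤ 8 := by exact_mod_cast hκ8
    linarith
  have hκr : (0 : ℝ) < κ := by exact_mod_cast hκ
  have hκ8r : (κ : ℝ) ≤ 8 := by exact_mod_cast hκ8
  obtain ⟨hh0, hh1⟩ := rsGhatSlope_critical_mem_Ioc hκr hκ8r (cotArg (sleDriving κ ω) z u)
  refine ⟨mul_nonneg (Real.rpow_nonneg (by linarith) _) hh0.le, ?_⟩
  calc derivRatio (sleDriving κ ω) z u ^ (1 - (κ : ℝ) / 8) * rsGhatSlope (1 - (κ : ℝ) / 8) κ _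
      ≤ R ^ (1 - (κ : ℝ) / 8) * 1 :=
        mul_le_mul (Real.rpow_le_rpow (by linarith) hψR hlam) hh1 hh0.le (Real.rpow_nonneg (by linarith) _)
    _ = R ^ (1 - (κ : ℝ) / 8) := mul_one _

/-- **The martingale identity `E[M_{σₙ}] = h(w₀)`** (`0 < κ`, `|w₀| < S`): the critical observable
stopped at the stopping time `σₙ ≤ ρₙ` (slope bounded by `S` on `[0, σₙ]`) is a martingale
(`martingale_stoppedProcess_sleRSObservable_of_le_locTime` at `a = 1 - κ/8`, discriminant `64`),
read at the times `0 ≤ n + 1`; `M₀ = Ĝ(ẑ) = h(Re z/Im z)`.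
[cite: RohdeSchramm2005, Lemma 6.3 (proof: "the optional sampling theorem then gives `Ĝ(ẑ) = M₀ = E[M_{t̄ₙ}]`")] -/
theorem integral_stoppedProcess_sleRSObservable_sleOnePtTime (hκ : 0 < κ) (hz : 0 < z.im) {S : ℝ}
    (h0 : |z.re / z.im| < S) (R : ℝ) (n : ℕ) (t : ℝ≥0) :
    ∫ ω, stoppedProcess (sleRSObservable κ (1 - (κ : ℝ) / 8) z) (sleOnePtTime κ z R S n) t ω
        ∂preWienerMeasure = rsGhatSlope (1 - (κ : ℝ) / 8) κ (z.re / z.im) := by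
  haveI := isProbabilityMeasure_preWienerMeasure'
  have hdisc : 0 ≤ 32 * (1 - (κ : ℝ) / 8) * (κ : ℝ) + (2 * (κ : ℝ) - 8) ^ 2 := by
    rw [discr_oneSub]; norm_num
  have hmart := martingale_stoppedProcess_sleRSObservable_of_le_locTime hκ hdisc hz
    (isStoppingTime_sleOnePtTime hz R S n) (sleOnePtTime_le_locTime R S n)
    fun ω t ht ↦ abs_cotArg_le_of_le_sleOnePtTime hz h0 ht
  have h1 := hmart.setIntegral_eq (zero_le : (0 : ℝ≥0) ≤ t) (s := univ) MeasurableSet.univ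
  rw [setIntegral_univ, setIntegral_univ] at h1
  rw [← h1]
  have h0' : ∀ ω, stoppedProcess (sleRSObservable κ (1 - (κ : ℝ) / 8) z) (sleOnePtTime κ z R S n) 0 ω =
      rsGhatSlope (1 - (κ : ℝ) / 8) κ (z.re / z.im) := fun ω ↦ by
    have hW : Continuous (sleDriving κ ω) := continuous_sleDriving κ ω
    rw [stoppedProcess_eq_of_le (by exact bot_le), sleRSObservable, rsObservable_zero hW hz,
      sleDriving_zero, Complex.ofReal_zero, sub_zero, rsGhat_eq_rsGhatSlope _ _ hz.ne']
  simp_rw [h0']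
  rw [integral_const, smul_eq_mul, probReal_univ, one_mul]

/-- The stopped values are measurable. [folklore] -/
theorem measurable_stoppedProcess_sleRSObservable_sleOnePtTime (hκ : 0 < κ) (hz : 0 < z.im) {S : ℝ}
    (h0 : |z.re / z.im| < S) (R : ℝ) (n : ℕ) (t : ℝ≥0) :
    Measurable fun ω ↦
      stoppedProcess (sleRSObservable κ (1 - (κ : ℝ) / 8) z) (sleOnePtTime κ z R S n) t ω := by
  have hdisc : 0 ≤ 32 * (1 - (κ : ℝ) / 8) * (κ : ℝ) + (2 * (κ : ℝ) - 8) ^ 2 := by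
    rw [discr_oneSub]; norm_num
  have hmart := martingale_stoppedProcess_sleRSObservable_of_le_locTime hκ hdisc hz
    (isStoppingTime_sleOnePtTime hz R S n) (sleOnePtTime_le_locTime R S n)
    fun ω t ht ↦ abs_cotArg_le_of_le_sleOnePtTime hz h0 ht
  exact ((hmart.stronglyMeasurable t).mono (brownianFiltration.le t)).measurable

end Martingale

/-! ### The event "`ψ` reaches `R` before the swallowing time" and its probability -/

section Reach

open Loewner Literature.Probability.Process Literature.Analysis.FunctionSpaces

variable (κ : ℝ≥0) (z : ℂ)

/-- **The event `A_R = {Z(z) ≥ R}` in measurable form**: the ratio `ψ` frozen at some localizing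
time `ρₘ` is `≥ R` (equivalently, by monotonicity of `ψ` and the exhaustion `ρₘ ↑ τ(z)`:
`ψₜ ≥ R` for some `t < τ(z)`, `mem_slePsiReach_iff`). [cite: RohdeSchramm2005, Lemma 6.3] -/
def slePsiReach (R : ℝ) : Set (ℝ≥0 → ℝ) :=
  {ω | ∃ m : ℕ, R ≤ stoppedProcess (slePointPsi κ z) (slePointLocTime κ z m) ((m : ℝ≥0) + 1) ω}

variable {κ z}

/-- `A_R` is measurable. [folklore] -/
theorem measurableSet_slePsiReach (hz : 0 < z.im) (R : ℝ) : MeasurableSet (slePsiReach κ z R) := by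
  have h : slePsiReach κ z R = ⋃ m : ℕ,
      {ω | R ≤ stoppedProcess (slePointPsi κ z) (slePointLocTime κ z m) ((m : ℝ≥0) + 1) ω} := by
    ext ω; simp [slePsiReach]
  rw [h]
  refine MeasurableSet.iUnion fun m ↦ measurableSet_le measurable_const ?_
  exact ((stronglyAdapted_stoppedProcess_slePointPsi hz (isStoppingTime_slePointLocTime κ hz m)
    (fun _ ↦ le_rfl) ((m : ℝ≥0) + 1)).mono (brownianFiltration.le _)).measurable

/-- The stopped clock `t ∧ x` for `x ≤ t` is `x` itself. [folklore] -/
theorem coe_untopA_min_of_le {t : ℝ≥0} {x : WithTop ℝ≥0} (h : x ≤ t) :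
    (((min (t : WithTop ℝ≥0) x).untopA : ℝ≥0) : WithTop ℝ≥0) = x := by
  obtain ⟨b, rfl⟩ := WithTop.ne_top_iff_exists.1 (ne_top_of_le_ne_top WithTop.coe_ne_top h)
  rw [min_eq_right h]
  rfl

/-- The localizing time as the stopped clock `(m + 1) ∧ ρₘ` (`ρₘ ≤ m + 1`). [folklore] -/
theorem coe_untopA_min_locTime (m : ℕ) (ω : ℝ≥0 → ℝ) :
    (((min ((((m : ℝ≥0) + 1 : ℝ≥0)) : WithTop ℝ≥0) (slePointLocTime κ z m ω)).untopA : ℝ≥0) :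
        WithTop ℝ≥0) = slePointLocTime κ z m ω :=
  coe_untopA_min_of_le (slePointLocTime_le m ω)

/-- **Off `A_R`, the ratio stays below `R` on `[0, τ(z))`.** [folklore] -/
theorem derivRatio_lt_of_notMem_slePsiReach (hz : 0 < z.im) {R : ℝ} {ω : ℝ≥0 → ℝ}
    (hω : ω ∉ slePsiReach κ z R) {t : ℝ≥0}
    (ht : (t : WithTop ℝ≥0) < swallowingTime (sleDriving κ ω) z) :
    derivRatio (sleDriving κ ω) z t < R := by
  obtain ⟨N, hN⟩ := exists_le_slePointLocTime (κ := κ) hz ω ht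
  by_contra hle
  push Not at hle
  apply hω
  refine ⟨N, hle.trans ?_⟩
  -- `ψ_t ≤ ψ_{ρ_N}` by monotonicity
  set u : ℝ≥0 := (min ((((N : ℝ≥0) + 1 : ℝ≥0)) : WithTop ℝ≥0) (slePointLocTime κ z N ω)).untopA with hu
  have huρ : ((u : ℝ≥0) : WithTop ℝ≥0) = slePointLocTime κ z N ω := coe_untopA_min_locTime N ω
  have htu : t ≤ u := by
    have := hN N le_rfl
    rw [← huρ] at this
    exact WithTop.coe_le_coe.1 this
  have huτ : ((u : ℝ≥0) : WithTop ℝ≥0) < swallowingTime (sleDriving κ ω) z := by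
    rw [huρ]; exact slePointLocTime_lt_swallowingTime hz N ω
  exact derivRatio_mono (continuous_sleDriving κ ω) hz htu huτ

/-- On `A_R` there is a time `t < τ(z)` with `ψₜ ≥ R`. [folklore] -/
theorem exists_derivRatio_ge_of_mem_slePsiReach (hz : 0 < z.im) {R : ℝ} {ω : ℝ≥0 → ℝ}
    (hω : ω ∈ slePsiReach κ z R) :
    ∃ t : ℝ≥0, (t : WithTop ℝ≥0) < swallowingTime (sleDriving κ ω) z ∧
      R ≤ derivRatio (sleDriving κ ω) z t := by
  obtain ⟨m, hm⟩ := hω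
  exact ⟨_, coe_untopA_min_lt_swallowingTime hz (fun _ ↦ le_rfl) _ ω, hm⟩

/-- **Off `A_R` the slope exits every level `S`**: if `|wₜ| < S` for all `t < τ(z)` then `ψₜ → ∞`
(`Loewner.tendsto_derivRatio_atTop_of_abs_cotArg_le`), so `ψ` would reach `R`. [cite: RohdeSchramm2005, Lemma 6.3 (proof)] -/
theorem sleCotArgExitTime_ne_top_of_notMem_slePsiReach (hz : 0 < z.im) {R : ℝ} {ω : ℝ≥0 → ℝ}
    (hω : ω ∉ slePsiReach κ z R) (S : ℝ) : sleCotArgExitTime κ z S ω ≠ ⊤ := by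
  intro htop
  have hW := continuous_sleDriving κ ω
  have htop' : cotArgExitTime (sleDriving κ ω) z S = ⊤ := htop
  have hs : ∀ r : ℝ≥0, (r : WithTop ℝ≥0) < swallowingTime (sleDriving κ ω) z →
      |cotArg (sleDriving κ ω) z r| ≤ S := fun r hr ↦
    (abs_cotArg_lt_of_cotArgExitTime_eq_top (sleDriving κ ω) z htop' hr).le
  have h0 : ((0 : ℝ≥0) : WithTop ℝ≥0) < swallowingTime (sleDriving κ ω) z :=
    swallowingTime_pos_holds hW (ne_driving_of_im_pos hz 0)
  haveI : Nonempty {r : ℝ≥0 // (r : WithTop ℝ≥0) < swallowingTime (sleDriving κ ω) z} := ⟨⟨0, h0⟩⟩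
  have hψ := tendsto_derivRatio_atTop_of_abs_cotArg_le hW hz hs
  obtain ⟨r, hr⟩ := (hψ.eventually_ge_atTop R).exists
  exact absurd hr (not_le.2 (derivRatio_lt_of_notMem_slePsiReach hz hω r.2))

/-- **Off `A_R`, for `n` large the stopping time `σₙ` is the exit time `T_S` of the slope**:
`T_S = t₀ < τ(z)` is finite, `ρₙ ≥ t₀` eventually, and the frozen ratio never reaches `R`.
[cite: RohdeSchramm2005, Lemma 6.3 (proof)] -/
theorem sleOnePtTime_eq_of_notMem_slePsiReach (hz : 0 < z.im) {R : ℝ}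
    {ω : ℝ≥0 → ℝ} (hω : ω ∉ slePsiReach κ z R) {S : ℝ} {t₀ : ℝ≥0}
    (ht₀ : sleCotArgExitTime κ z S ω = t₀) {n : ℕ}
    (hn : ((t₀ : ℝ≥0) : WithTop ℝ≥0) ≤ slePointLocTime κ z n ω) :
    sleOnePtTime κ z R S n ω = t₀ := by
  -- the frozen ratio stays in `(0, R)`, so `σ_R = ⊤`
  have hexit : slePsiExitTime κ z R n ω = ⊤ := by
    refine hittingAfter_zero_apply_of_forall fun t ↦ ?_
    rw [mem_compl_iff, not_not]
    have hT := coe_untopA_min_lt_swallowingTime hz (σ := slePointLocTime κ z n) (fun _ ↦ le_rfl) t ω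
      (κ := κ)
    refine ⟨?_, derivRatio_lt_of_notMem_slePsiReach hz hω hT⟩
    exact one_pos.trans_le (one_le_derivRatio (continuous_sleDriving κ ω) hz hT)
  rw [sleOnePtTime, hexit, min_eq_right le_top, sleCotArgLocTime, ht₀, min_eq_left hn]

/-- **The terminal value off `A_R`**: for `n` large, `M_{σₙ} = ψ_{t₀}^{1-κ/8} h(S)`
with `ψ_{t₀} < R`, where `t₀ = T_S` (`|w_{T_S}| = S` when `|w₀| < S`). [cite: RohdeSchramm2005, Lemma 6.3 (proof)] -/
theorem stoppedProcess_eq_of_notMem_slePsiReach (hκ : 0 < κ) (hz : 0 < z.im) {R : ℝ}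
    {ω : ℝ≥0 → ℝ} (hω : ω ∉ slePsiReach κ z R) {S : ℝ} (h0 : |z.re / z.im| < S) {t₀ : ℝ≥0}
    (ht₀ : sleCotArgExitTime κ z S ω = t₀) {n : ℕ}
    (hn : ((t₀ : ℝ≥0) : WithTop ℝ≥0) ≤ slePointLocTime κ z n ω) :
    stoppedProcess (sleRSObservable κ (1 - (κ : ℝ) / 8) z) (sleOnePtTime κ z R S n) ((n : ℝ≥0) + 1) ω =
      derivRatio (sleDriving κ ω) z t₀ ^ (1 - (κ : ℝ) / 8) * rsGhatSlope (1 - (κ : ℝ) / 8) κ S := by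
  have hW := continuous_sleDriving κ ω
  have hσ := sleOnePtTime_eq_of_notMem_slePsiReach hz hω ht₀ hn
  have ht₀n : ((t₀ : ℝ≥0) : WithTop ℝ≥0) ≤ (((n : ℝ≥0) + 1 : ℝ≥0) : WithTop ℝ≥0) :=
    hn.trans (slePointLocTime_le n ω)
  have hu : (min ((((n : ℝ≥0) + 1 : ℝ≥0)) : WithTop ℝ≥0) (sleOnePtTime κ z R S n ω)).untopA = t₀ := by
    rw [hσ, min_eq_right ht₀n]; rfl
  rw [stoppedProcess_sleRSObservable_sleOnePtTime_eq hz R S n _ ω, hu]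
  have h0' : |cotArg (sleDriving κ ω) z 0| < S := by rwa [cotArg_sleDriving_zero κ ω hz]
  have habs : |cotArg (sleDriving κ ω) z t₀| = S := abs_cotArg_cotArgExitTime hW hz h0' ht₀
  have hκr : (0 : ℝ) < κ := by exact_mod_cast hκ
  rw [← rsGhatSlope_critical_abs hκr (cotArg (sleDriving κ ω) z t₀), habs]

/-- **The tail lower bound `P[Z(z) ≥ R] ≥ ½ (sin arg z)^{8/κ-1} R^{-(1-κ/8)}`** for `0 < κ < 8`,
`z ∈ ℍ`, `R > 1`, in the form `h(w₀)/2 ≤ R^{1-κ/8} P(A_R)`, `h(w₀) = (1 + w₀²)^{-(4/κ-1/2)}`,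
`w₀ = Re z/Im z`. Optional stopping of the critical martingale `ψ^{1-κ/8} h(w)` at
`σₙ = σ_R ∧ T_S ∧ ρₙ` (`E[M_{σₙ}] = h(w₀)`, `0 ≤ M_{σₙ} ≤ R^{1-κ/8}`), where on the complement of
`A_R` the values `M_{σₙ}` are eventually the constant `ψ_{T_S}^{1-κ/8} h(±S) ≤ R^{1-κ/8} h(S)`
(dominated convergence), and `S` is chosen with `h(S) ≤ h(w₀)/(2R^{1-κ/8})`. This is Beffara's
(2.8): "`sin(α₀/2)^{8/κ-1} = e^{(1-κ/8)s} P(S ≥ s) E[sin(α_s/2)^{8/κ-1} | S ≥ s]`" read as a lower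
bound for the survival probability. [cite: Beffara2008, Prop. 4 (proof, eq. (2.8))] -/
theorem rsGhatSlope_le_measureReal_slePsiReach (hκ : 0 < κ) (hκ8 : κ < 8) (hz : 0 < z.im) {R : ℝ}
    (hR : 1 < R) :
    rsGhatSlope (1 - (κ : ℝ) / 8) κ (z.re / z.im) / 2 ≤
      R ^ (1 - (κ : ℝ) / 8) * preWienerMeasure.real (slePsiReach κ z R) := by
  haveI := isProbabilityMeasure_preWienerMeasure'
  set a : ℝ := 1 - (κ : ℝ) / 8 with ha
  set h0 : ℝ := rsGhatSlope a κ (z.re / z.im) with hh0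
  set A : Set (ℝ≥0 → ℝ) := slePsiReach κ z R with hA
  have hκr : (0 : ℝ) < κ := by exact_mod_cast hκ
  have hκ8r : (κ : ℝ) < 8 := by exact_mod_cast hκ8
  have hh0pos : 0 < h0 := (rsGhatSlope_critical_mem_Ioc hκr hκ8r.le _).1
  have hRa : 0 < R ^ a := Real.rpow_pos_of_pos (by linarith) _
  set c : ℝ := h0 / (2 * R ^ a) with hc
  have hcpos : 0 < c := by positivity
  -- choose the level `S`
  obtain ⟨S, hS0, hSc⟩ : ∃ S : ℝ, |z.re / z.im| < S ∧ rsGhatSlope a κ S ≤ c := by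
    have h1 := (tendsto_rsGhatSlope_critical_atTop hκr hκ8r).eventually (eventually_le_nhds hcpos)
    have h2 := eventually_gt_atTop |z.re / z.im|
    obtain ⟨S, hS1, hS2⟩ := (h1.and h2).exists
    exact ⟨S, hS2, hS1⟩
  have hA_meas : MeasurableSet A := measurableSet_slePsiReach hz R
  -- the stopped values
  set M : ℕ → (ℝ≥0 → ℝ) → ℝ := fun n ω ↦
    stoppedProcess (sleRSObservable κ a z) (sleOnePtTime κ z R S n) ((n : ℝ≥0) + 1) ω with hM
  have hMmeas : ∀ n, Measurable (M n) := fun n ↦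
    measurable_stoppedProcess_sleRSObservable_sleOnePtTime hκ hz hS0 R n _
  have hMmem : ∀ n ω, M n ω ∈ Icc (0 : ℝ) (R ^ a) := fun n ω ↦
    stoppedProcess_sleRSObservable_sleOnePtTime_mem_Icc hκ hκ8.le hz hR S n _ ω
  have hMint : ∀ n, Integrable (M n) preWienerMeasure := fun n ↦
    Integrable.of_bound (hMmeas n).aestronglyMeasurable (R ^ a) (ae_of_all _ fun ω ↦ by
      rw [Real.norm_eq_abs, abs_of_nonneg (hMmem n ω).1]; exact (hMmem n ω).2)
  have hEM : ∀ n, ∫ ω, M n ω ∂preWienerMeasure = h0 := fun n ↦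
    integral_stoppedProcess_sleRSObservable_sleOnePtTime hκ hz hS0 R n _
  -- the part on `A`
  have hIA : ∀ n, ∫ ω in A, M n ω ∂preWienerMeasure ≤ R ^ a * preWienerMeasure.real A := by
    intro n
    have h := norm_setIntegral_le_of_norm_le_const (measure_lt_top preWienerMeasure A)
      (f := M n) (C := R ^ a) fun ω _ ↦ by
        rw [Real.norm_eq_abs, abs_of_nonneg (hMmem n ω).1]; exact (hMmem n ω).2
    exact (le_abs_self _).trans h
  -- the part off `A`: dominated convergence to a limit bounded by `R^a c`
  have hFlim : ∀ ω, ∃ g : ℝ, Tendsto (fun n ↦ Aᶜ.indicator (M n) ω) atTop (𝓝 g) ∧ 0 ≤ g ∧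
      g ≤ R ^ a * c := by
    intro ω
    by_cases hω : ω ∈ A
    · have hF0 : ∀ n, Aᶜ.indicator (M n) ω = 0 := fun n ↦
        indicator_of_notMem (Set.notMem_compl_iff.2 hω) _
      refine ⟨0, ?_, le_rfl, by positivity⟩
      simp_rw [hF0]
      exact tendsto_const_nhds
    · -- eventually constant
      obtain ⟨t₀, ht₀⟩ := WithTop.ne_top_iff_exists.1
        (sleCotArgExitTime_ne_top_of_notMem_slePsiReach hz hω S)
      have ht₀' : sleCotArgExitTime κ z S ω = t₀ := ht₀.symm
      have ht₀τ := (lt_swallowingTime_of_cotArgExitTime_eq_coe (continuous_sleDriving κ ω) hz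
        (show cotArgExitTime (sleDriving κ ω) z S = t₀ from ht₀')).1
      obtain ⟨N, hN⟩ := exists_le_slePointLocTime (κ := κ) hz ω ht₀τ
      set V : ℝ := derivRatio (sleDriving κ ω) z t₀ ^ a * rsGhatSlope a κ S with hV
      have hFV : ∀ n, N ≤ n → Aᶜ.indicator (M n) ω = V := fun n hn ↦ by
        rw [indicator_of_mem (show ω ∈ Aᶜ from hω)]
        exact stoppedProcess_eq_of_notMem_slePsiReach hκ hz hω hS0 ht₀' (hN n hn)
      have ht : Tendsto (fun n ↦ Aᶜ.indicator (M n) ω) atTop (𝓝 V) :=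
        tendsto_const_nhds.congr' (by
          filter_upwards [eventually_ge_atTop N] with n hn using (hFV n hn).symm)
      have hψ : derivRatio (sleDriving κ ω) z t₀ < R := derivRatio_lt_of_notMem_slePsiReach hz hω ht₀τ
      have hψ1 : 1 ≤ derivRatio (sleDriving κ ω) z t₀ :=
        one_le_derivRatio (continuous_sleDriving κ ω) hz ht₀τ
      have ha0 : 0 ≤ a := by
        have : (κ : ℝ) < 8 := by exact_mod_cast hκ8
        rw [ha]; linarith
      have hhS : 0 < rsGhatSlope a κ S := (rsGhatSlope_critical_mem_Ioc hκr hκ8r.le S).1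
      refine ⟨V, ht, by positivity, ?_⟩
      exact mul_le_mul (Real.rpow_le_rpow (by linarith) hψ.le ha0) hSc hhS.le hRa.le
  choose G hG using hFlim
  have hFmeas : ∀ n, AEStronglyMeasurable (Aᶜ.indicator (M n)) preWienerMeasure := fun n ↦
    ((hMmeas n).indicator hA_meas.compl).aestronglyMeasurable
  have hFbd : ∀ n, ∀ᵐ ω ∂preWienerMeasure, ‖Aᶜ.indicator (M n) ω‖ ≤ R ^ a := fun n ↦
    ae_of_all _ fun ω ↦ by
      rw [Real.norm_eq_abs]
      by_cases hω : ω ∈ Aᶜ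
      · rw [indicator_of_mem hω, abs_of_nonneg (hMmem n ω).1]; exact (hMmem n ω).2
      · rw [indicator_of_notMem hω, abs_zero]; exact hRa.le
  have hDCT := tendsto_integral_of_dominated_convergence (fun _ ↦ R ^ a) hFmeas (integrable_const _)
    hFbd (ae_of_all _ fun ω ↦ (hG ω).1)
  have hGint : ∫ ω, G ω ∂preWienerMeasure ≤ R ^ a * c := by
    calc ∫ ω, G ω ∂preWienerMeasure ≤ ∫ _ω, R ^ a * c ∂preWienerMeasure :=
          integral_mono_of_nonneg (ae_of_all _ fun ω ↦ (hG ω).2.1) (integrable_const _)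
            (ae_of_all _ fun ω ↦ (hG ω).2.2)
      _ = R ^ a * c := by rw [integral_const, smul_eq_mul, probReal_univ, one_mul]
  -- assemble: `h0 ≤ R^a P(A) + ∫ 𝟙_{Aᶜ} M n` for all `n`, pass to the limit
  have hsplit : ∀ n, h0 ≤ R ^ a * preWienerMeasure.real A +
      ∫ ω, Aᶜ.indicator (M n) ω ∂preWienerMeasure := by
    intro n
    rw [← hEM n, ← integral_add_compl hA_meas (hMint n), integral_indicator hA_meas.compl]
    exact add_le_add (hIA n) le_rfl
  have hlim : h0 ≤ R ^ a * preWienerMeasure.real A + ∫ ω, G ω ∂preWienerMeasure :=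
    ge_of_tendsto (tendsto_const_nhds.add hDCT) (Eventually.of_forall hsplit)
  have hkey : h0 ≤ R ^ a * preWienerMeasure.real A + h0 / 2 := by
    have : R ^ a * c = h0 / 2 := by rw [hc]; field_simp
    linarith [hlim, hGint]
  linarith

end Reach

/-! ### From `Z(z) ≥ R` to `dist(z, γ) ≤ 2 Im z / R` (eq. (6.2), Schwarz direction) -/

section Distance

open Loewner Literature.Probability.Process

variable {κ : ℝ≥0} {z : ℂ}

/-- **On `A_R` the trace comes `2 Im z / R`-close to `z`** (`R > 2`, chain generated by a curve):
at a time `t < τ(z)` with `ψₜ ≥ R`, `dist(z, γ[0,∞) ∪ ℝ) ≤ dist(z, Hₜᶜ) ≤ 2 Im gₜ(z)/|gₜ'(z)| =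
2 Im z/ψₜ ≤ 2 Im z/R < Im z` (Rohde–Schramm's (6.2), right inequality:
`infDist_range_le_infDist_compl_domain`, `infDist_compl_domain_mul_norm_deriv_map_le`), and a
point of `γ[0,∞) ∪ ℝ` closer than `Im z` lies on the trace. [cite: RohdeSchramm2005, eq. (6.2)] -/
theorem infDist_sleTrace_le_of_mem_slePsiReach (hz : 0 < z.im) {R : ℝ} (hR : 2 < R) {ω : ℝ≥0 → ℝ}
    (hgen : ∃ γ, IsGeneratedByCurve (sleDriving κ ω) γ) (hω : ω ∈ slePsiReach κ z R) :
    infDist z (range (sleTrace κ ω)) ≤ 2 * z.im / R := by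
  obtain ⟨t, ht, hRψ⟩ := exists_derivRatio_ge_of_mem_slePsiReach hz hω
  have hW : Continuous (sleDriving κ ω) := continuous_sleDriving κ ω
  have hg : IsGeneratedByCurve (sleDriving κ ω) (sleTrace κ ω) := isGeneratedByCurve_trace hgen
  have hzdom : z ∈ domain (sleDriving κ ω) t := (mem_domain_iff _ _ _).2 ⟨hz, ht⟩
  have him : 0 < (map (sleDriving κ ω) t z).im := mapsTo_map hW t hzdom
  set Sset : Set ℂ := range (sleTrace κ ω) ∪ {w : ℂ | w.im = 0} with hS
  have h1 : infDist z Sset ≤ infDist z (domain (sleDriving κ ω) t)ᶜ :=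
    hg.infDist_range_le_infDist_compl_domain hzdom
  have h2 := infDist_compl_domain_mul_norm_deriv_map_le hW hzdom
  rw [derivRatio_apply, le_div_iff₀ him] at hRψ
  have hR0 : 0 < R := by linarith
  set r := infDist z (domain (sleDriving κ ω) t)ᶜ with hr
  set D := ‖deriv (map (sleDriving κ ω) t) z‖ with hD
  have hDpos : 0 < D := by
    refine lt_of_not_ge fun hD0 ↦ ?_
    have : z.im * D ≤ 0 := mul_nonpos_of_nonneg_of_nonpos hz.le hD0
    nlinarith [mul_pos hR0 him]
  have h4 : r * D * R ≤ 2 * (z.im * D) := by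
    calc r * D * R ≤ 2 * (map (sleDriving κ ω) t z).im * R := by gcongr
      _ = 2 * (R * (map (sleDriving κ ω) t z).im) := by ring
      _ ≤ 2 * (z.im * D) := by gcongr
  have h5 : r * R ≤ 2 * z.im := le_of_mul_le_mul_right (by nlinarith [h4]) hDpos
  have h6 : r ≤ 2 * z.im / R := by rw [le_div_iff₀ hR0]; exact h5
  have hρ : 2 * z.im / R < z.im := by
    rw [div_lt_iff₀ hR0]; nlinarith
  have hSle : infDist z Sset ≤ 2 * z.im / R := h1.trans h6
  -- the union is at distance `< Im z`, so the trace is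
  by_contra hgt
  push Not at hgt
  have hne : Sset.Nonempty := ⟨(0 : ℂ), Or.inr (by simp)⟩
  have hge : min (infDist z (range (sleTrace κ ω))) z.im ≤ infDist z Sset := by
    rw [le_infDist hne]
    intro y hy
    rcases hy with hy | hy
    · exact (min_le_left _ _).trans (infDist_le_dist_of_mem hy)
    · refine (min_le_right _ _).trans ?_
      have h1 : |(z - y).im| ≤ ‖z - y‖ := abs_im_le_norm _
      rw [Complex.sub_im, show y.im = 0 from hy, sub_zero, abs_of_pos hz] at h1
      rwa [dist_eq_norm]
  have : min (infDist z (range (sleTrace κ ω))) z.im ≤ 2 * z.im / R := hge.trans hSle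
  rcases min_le_iff.1 this with h | h
  · linarith
  · linarith

/-- **Beffara's Prop. 4, lower bound, at one point**: for `0 < κ < 8`, SLE_κ generated by a curve,
`z ∈ ℍ` and `0 < ε < Im z`,
`P[dist(z, γ[0,∞)) ≤ ε] ≥ ½ (sin arg z)^{8/κ-1} (ε/(2 Im z))^{1-κ/8}`, where
`(sin arg z)^{8/κ-1} = (1 + (Re z/Im z)²)^{-(4/κ-1/2)} = rsGhatSlope (1-κ/8) κ (Re z/Im z)`.
(Tail bound `rsGhatSlope_le_measureReal_slePsiReach` at `R = 2 Im z/ε` and the geometry of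
`infDist_sleTrace_le_of_mem_slePsiReach`.) Beffara (2008), Prop. 4:
`P(B(z₀, ε) ∩ γ[0,∞) ≠ ∅) ≍ (ε/Im z₀)^{1-κ/8} (sin arg z₀)^{8/κ-1}` — here the lower inequality,
with explicit constant `2^{-(2-κ/8)}`. [cite: Beffara2008, Prop. 4] -/
theorem measure_infDist_sleTrace_le_ge (hκ : 0 < κ) (hκ8 : κ < 8) (hT : HasSLETrace κ)
    (hz : 0 < z.im) {ε : ℝ} (hε : 0 < ε) (hεz : ε < z.im) :
    ENNReal.ofReal (rsGhatSlope (1 - (κ : ℝ) / 8) κ (z.re / z.im) / 2 *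
        (ε / (2 * z.im)) ^ (1 - (κ : ℝ) / 8)) ≤
      preWienerMeasure {ω | infDist z (range (sleTrace κ ω)) ≤ ε} := by
  haveI := isProbabilityMeasure_preWienerMeasure'
  set a : ℝ := 1 - (κ : ℝ) / 8 with ha
  set R : ℝ := 2 * z.im / ε with hRdef
  have hR2 : 2 < R := by
    rw [hRdef, lt_div_iff₀ hε]; nlinarith
  have hR0 : 0 < R := by linarith
  have htail := rsGhatSlope_le_measureReal_slePsiReach hκ hκ8 hz (R := R) (by linarith)
  have hRa : 0 < R ^ a := Real.rpow_pos_of_pos hR0 _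
  -- `P(A) ≥ (h/2) R^{-a} = (h/2) (ε/(2 Im z))^a`
  have hinv : (ε / (2 * z.im)) ^ a = (R ^ a)⁻¹ := by
    rw [hRdef, ← Real.inv_rpow hR0.le, inv_div]
  have hreal : rsGhatSlope a κ (z.re / z.im) / 2 * (ε / (2 * z.im)) ^ a ≤
      preWienerMeasure.real (slePsiReach κ z R) := by
    rw [hinv, ← div_eq_mul_inv, div_le_iff₀ hRa, mul_comm]
    exact htail
  -- `A ∩ {generated by a curve} ⊆ {dist ≤ ε}`
  set Good : Set (ℝ≥0 → ℝ) := {ω | ∃ γ, IsGeneratedByCurve (sleDriving κ ω) γ} with hGood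
  have hGc : preWienerMeasure Goodᶜ = 0 := by
    have h : ∀ᵐ ω ∂preWienerMeasure, ω ∈ Good := hT
    exact mem_ae_iff.1 (Filter.eventually_iff.1 h)
  have hsub : slePsiReach κ z R ∩ Good ⊆ {ω | infDist z (range (sleTrace κ ω)) ≤ ε} := by
    rintro ω ⟨hA, hg⟩
    have h := infDist_sleTrace_le_of_mem_slePsiReach hz hR2 hg hA
    have hRε : 2 * z.im / R = ε := by
      rw [hRdef]; field_simp
    rw [hRε] at h
    exact h
  calc ENNReal.ofReal (rsGhatSlope a κ (z.re / z.im) / 2 * (ε / (2 * z.im)) ^ a)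
      ≤ ENNReal.ofReal (preWienerMeasure.real (slePsiReach κ z R)) := ENNReal.ofReal_le_ofReal hreal
    _ = preWienerMeasure (slePsiReach κ z R) := ENNReal.ofReal_toReal (measure_ne_top _ _)
    _ = preWienerMeasure (slePsiReach κ z R ∩ Good) := (measure_inter_conull hGc).symm
    _ ≤ preWienerMeasure {ω | infDist z (range (sleTrace κ ω)) ≤ ε} := measure_mono hsub

/-- **The one-point lower estimate on compact sets, in the format of Beffara's condition 1**
(hypothesis `hB` of `ae_dimH_range_sleTrace_of_root_facts_of_local_estimates`,
`CritPercSLEDimensionLower.lean`): for `0 < κ < 8`, SLE_κ generated by a curve, and a compact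
`K ⊆ ℍ`, there are `c₁ > 0` and `ε₀ > 0` with `c₁ ε^{1-κ/8} ≤ P[dist(z, γ[0,∞)) ≤ ε]` for all
`z ∈ K`, `0 < ε ≤ ε₀` (`Im z ≥ m`, `Im z ≤ M`, `|Re z| ≤ B` on `K`; `ε₀ = m/2`,
`c₁ = ½ h(B/m) (2M)^{-(1-κ/8)}`, `h(w) = (1 + w²)^{-(4/κ-1/2)}`). [cite: Beffara2008, Prop. 4] -/
theorem exists_onePoint_lower_of_isCompact (hκ : 0 < κ) (hκ8 : κ < 8) (hT : HasSLETrace κ)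
    (K : Set ℂ) (hK : IsCompact K) (hKH : K ⊆ upperHalfPlaneSet) :
    ∃ c₁ : ℝ≥0∞, c₁ ≠ 0 ∧ ∃ ε₀ : ℝ, 0 < ε₀ ∧ ∀ ε : ℝ, 0 < ε → ε ≤ ε₀ → ∀ z ∈ K,
      c₁ * ENNReal.ofReal (ε ^ (1 - (κ : ℝ) / 8)) ≤
        preWienerMeasure {ω | infDist z (range (sleTrace κ ω)) ≤ ε} := by
  rcases K.eq_empty_or_nonempty with rfl | hne
  · exact ⟨1, one_ne_zero, 1, one_pos, fun ε _ _ z hz ↦ (notMem_empty z hz).elim⟩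
  set a : ℝ := 1 - (κ : ℝ) / 8 with ha
  have hκ' : (0 : ℝ) < κ := by exact_mod_cast hκ
  have hκ8r : (κ : ℝ) < 8 := by exact_mod_cast hκ8
  -- bounds on `K`
  obtain ⟨zm, hzmK, hzm⟩ := hK.exists_isMinOn hne Complex.continuous_im.continuousOn
  obtain ⟨zM, hzMK, hzM⟩ := hK.exists_isMaxOn hne Complex.continuous_im.continuousOn
  obtain ⟨zB, hzBK, hzB⟩ := hK.exists_isMaxOn hne (continuous_abs.comp Complex.continuous_re).continuousOn
  set m : ℝ := zm.im with hm
  set M : ℝ := zM.im with hM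
  set B : ℝ := |zB.re| with hB
  have hm0 : 0 < m := hKH hzmK
  have hM0 : 0 < M := hKH hzMK
  have hB0 : 0 ≤ B := abs_nonneg _
  -- the constant
  set h₁ : ℝ := rsGhatSlope a κ (B / m) with hh₁
  have hh₁pos : 0 < h₁ := (rsGhatSlope_critical_mem_Ioc hκ' hκ8r.le _).1
  set c : ℝ := h₁ / 2 * (2 * M) ^ (-a) with hc
  have hcpos : 0 < c := by positivity
  refine ⟨ENNReal.ofReal c, (ENNReal.ofReal_pos.2 hcpos).ne', m / 2, by positivity,
    fun ε hε hεm z hz ↦ ?_⟩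
  have hzim : m ≤ z.im := hzm hz
  have hziM : z.im ≤ M := hzM hz
  have hzre : |z.re| ≤ B := hzB hz
  have hz0 : 0 < z.im := hm0.trans_le hzim
  have hεz : ε < z.im := by linarith
  have hmain := measure_infDist_sleTrace_le_ge hκ hκ8 hT hz0 hε hεz
  refine le_trans ?_ hmain
  rw [← ENNReal.ofReal_mul hcpos.le]
  refine ENNReal.ofReal_le_ofReal ?_
  -- `c ε^a ≤ (h(w₀)/2) (ε/(2 Im z))^a`
  have hw : |z.re / z.im| ≤ B / m := by
    rw [abs_div, abs_of_pos hz0]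
    exact div_le_div₀ hB0 hzre hm0 hzim
  have hh : h₁ ≤ rsGhatSlope a κ (z.re / z.im) := rsGhatSlope_critical_le_of_abs_le hκ' hκ8r.le hw
  have ha0 : 0 ≤ a := by
    have : (κ : ℝ) < 8 := by exact_mod_cast hκ8
    rw [ha]; linarith
  have hpow : (2 * M) ^ (-a) * ε ^ a ≤ (ε / (2 * z.im)) ^ a := by
    rw [div_eq_mul_inv, Real.mul_rpow hε.le (by positivity), mul_comm, Real.rpow_neg (by positivity),
      ← Real.inv_rpow (by positivity)]
    gcongr
  have hpos : 0 ≤ rsGhatSlope a κ (z.re / z.im) / 2 :=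
    div_nonneg (rsGhatSlope_critical_mem_Ioc hκ' hκ8r.le _).1.le zero_le_two
  calc c * ε ^ a = h₁ / 2 * ((2 * M) ^ (-a) * ε ^ a) := by rw [hc]; ring
    _ ≤ rsGhatSlope a κ (z.re / z.im) / 2 * (ε / (2 * z.im)) ^ a := by
        gcongr

end Distance




end Literature.Probability.RandomPlanarGeometry

end
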